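import Mathlib
import Summits.ResolutionOfSingularities.ResolutionOfSingularities.Theorems.HomologicalConductorPersistencePointedCeilingCurvette
import Summits.ResolutionOfSingularities.ResolutionOfSingularities.Theorems.HomologicalConductorPersistencePointedCyclesPath
import HarnessLib

/-!
# [OURS · L1 w44b] K-PCC sheaf half, FILE 6: the PYRAMID INEQUALITY `v_{C_{e k}}(x) ≥ min(k, ℓ+1−k)` for
# `x ∈ ca³(T)` along an embedded `A_ℓ`-path carrying a curvette at its middle curve (K-PCC Cor 4.4, T-side)

Rung S-2 `HomologicalConductor.PersistenceSurface` (stmt-ResolutionOfSingularities-19970), route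
`ResolutionOfSingularities/HomologicalConductor`, chain W4.4b (cell res-hironaka), WAVE-3 row «stub-3 → K-PCC SHEAF HALF»
(lead memo K-PCC, res-L1-w44b-lead-1 g4, Thm 4.3 / Cor 4.4). `[OURS · L1 w44b]`; NOT a statement of the manuscript
under review; AI-written, weaker than expert review. Composition of FILE 4b `…PointedCeilingCurvette`
(`least_sub_greatest_le_ord_of_mem_cohomologyAnnihilatorOfDegree_three`: `Z₀ − A₀ ≤ ord(x)`) with lead-1's lattice
consumer `PersistencePointedCyclesPath.pyramid_le_of_dominates_pointed` (p568327): when the curvette sits at the middle curve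
`e m` of an embedded `A_ℓ`-path of exceptional curves (`M (e k)(e k) = −2`, `M (e k)(e (k+1)) = 1`), NP holds there
(`A₀ = 0`) and `Z₀ = Z⁽ᵉᵐ⁾` is itself pointed anti-nef (the least element is a member,
`PersistencePointedCycles.exists_least_of_infClosed`), every non-zero `x ∈ ca³(T)` has
**`v_{C_{e k}}(x) ≥ min(k, ℓ + 1 − k)`** for `1 ≤ k ≤ ℓ` — the T-side of K-PCC Cor 4.4 («`x` lies in the pyramid ideal
`I_W(pyramid) = (u, v, w^{⌈ℓ/2⌉}) = ca(A_ℓ)` of the `A_ℓ` arrival», whose W-side identification is the chain's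
`TruncatedPrincipalCeiling` / arena files).

* `pyramid_le_ord_of_mem_cohomologyAnnihilatorOfDegree_three` — the statement above, with the binders of FILE 4b
  (`X` regular, `π` proper birational, `dim T = 2`, `F ⊇` codimension-`≤ 1` points of the closed fibre, `hneg`, curvette
  `γ` with `([Γ]·E_i) = δ_{i, e m}`).

References: J. Lipman, Publ. Math. IHÉS 36 (1969), §12, §14 [`Lipman1969`]; memo K-PCC §4 (this work).
-/

set_option linter.dupNamespace false
set_option autoImplicit false

noncomputable section

open CategoryTheory AlgebraicGeometry TopologicalSpace IsLocalRing Opposite Order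
open Literature.AlgebraicGeometry.Motives Literature.AlgebraicGeometry.Motives.RatFn
open Literature.AlgebraicGeometry.Resolution Literature.RingTheory.CohomologyAnnihilator
open Summit.ResolutionOfSingularities.ResolutionOfSingularities.Theorems.NoZeno.SandwichCluster

universe u

namespace Summit.ResolutionOfSingularities.ResolutionOfSingularities.Theorems.HomologicalConductor.PersistencePointedCeiling

variable {X : Scheme.{u}} [IsIntegral X] [IsLocallyNoetherian X] {T : Type u} [CommRing T] [IsLocalRing T] [IsDomain T]
  [IsNoetherianRing T] [IsIntegrallyClosed T] (π : X ⟶ Spec (.of T)) [IsProper π] [DecidableEq X]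

/-- **PYRAMID INEQUALITY for `ca³(T)` along an `A_ℓ`-path with a curvette at its middle (K-PCC Cor 4.4, T-side).**
Binders as in FILE 4b's pointed ceiling; additionally `e : ℕ → F` an embedded `A_ℓ`-path of exceptional curves
(`1 ≤ k ≤ ℓ`, injective, self-intersections `−2`, consecutive intersections `1`) with middle index `m`
(`ℓ ≤ 2m ≤ ℓ + 2`), the curvette `γ` at `t = e m`, `Z₀` the LEAST effective cycle pointed anti-nef at `e m` (a member:
`hZ₀mem`, and least: `hZ₀`) and NP at `e m` (every effective almost-nef cycle is `0`, i.e. `A₀ = 0`). Then for every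
non-zero `x ∈ ca³(T)` and `1 ≤ k ≤ ℓ`: `min(k, ℓ+1−k) ≤ ord_{E_{e k}}(x)`. [cite: Lipman1969, Section 12 and Lemma (14.1)] -/
theorem pyramid_le_ord_of_mem_cohomologyAnnihilatorOfDegree_three (hX : Scheme.IsRegular X)
    (hπ : IsBirational π) (hT : ringKrullDim T = 2) (F : Finset X)
    (hF : ∀ η ∈ F, coheight η = 1) (hFexc : ∀ η ∈ F, η ∈ excCurvePoints π)
    (hFE : ∀ ζ : X, π ζ = closedPoint T → coheight ζ ≤ 1 → ζ ∈ F)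
    (hneg : ∀ N : {η // η ∈ F} → ℤ, 0 ≤ ∑ i, N i * ∑ j, N j *
        excCurveDegree π (CartierDivisor.ofIsEffectiveCartier (primeDivisorIdeal (j : X))
          (isEffectiveCartier_primeDivisorIdeal_of_isRegular hX (hF j j.2))) i → N = 0)
    (ℓ m : ℕ) (e : ℕ → {η // η ∈ F})
    (hinj : ∀ a b, 1 ≤ a → a ≤ ℓ → 1 ≤ b → b ≤ ℓ → e a = e b → a = b)
    (hdiag : ∀ k, 1 ≤ k → k ≤ ℓ → excCurveDegree π (CartierDivisor.ofIsEffectiveCartier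
        (primeDivisorIdeal ((e k : {η // η ∈ F}) : X))
          (isEffectiveCartier_primeDivisorIdeal_of_isRegular hX (hF (e k) (e k).2))) (e k) = -2)
    (hadj : ∀ k, 1 ≤ k → k + 1 ≤ ℓ →
        excCurveDegree π (CartierDivisor.ofIsEffectiveCartier (primeDivisorIdeal ((e k : {η // η ∈ F}) : X))
          (isEffectiveCartier_primeDivisorIdeal_of_isRegular hX (hF (e k) (e k).2))) (e (k + 1)) = 1 ∧
        excCurveDegree π (CartierDivisor.ofIsEffectiveCartier (primeDivisorIdeal ((e (k + 1) : {η // η ∈ F}) : X))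
          (isEffectiveCartier_primeDivisorIdeal_of_isRegular hX (hF (e (k + 1)) (e (k + 1)).2))) (e k) = 1)
    (hm1 : 1 ≤ m) (hm2 : m ≤ ℓ) (hmid1 : ℓ ≤ 2 * m) (hmid2 : 2 * m ≤ ℓ + 2)
    {γ : X} (hγ : coheight γ = 1) (hγE : π.base γ ≠ closedPoint T)
    (hΓ : ∀ i : {η // η ∈ F}, excCurveDegree π (CartierDivisor.ofIsEffectiveCartier (primeDivisorIdeal γ)
      (isEffectiveCartier_primeDivisorIdeal_of_isRegular hX hγ)) i = (if i = e m then 1 else 0))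
    (Z₀ : {η // η ∈ F} → ℕ)
    (hZ₀mem : ∀ i : {η // η ∈ F}, ∑ j, (Z₀ j : ℤ) *
        excCurveDegree π (CartierDivisor.ofIsEffectiveCartier (primeDivisorIdeal (j : X))
          (isEffectiveCartier_primeDivisorIdeal_of_isRegular hX (hF j j.2))) i ≤ -(if i = e m then 1 else 0))
    (hZ₀ : ∀ Z : {η // η ∈ F} → ℕ, (∀ i : {η // η ∈ F}, ∑ j, (Z j : ℤ) *
        excCurveDegree π (CartierDivisor.ofIsEffectiveCartier (primeDivisorIdeal (j : X))
          (isEffectiveCartier_primeDivisorIdeal_of_isRegular hX (hF j j.2))) i ≤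
        -(if i = e m then 1 else 0)) → Z₀ ≤ Z)
    (hNP : ∀ A : {η // η ∈ F} → ℕ, (∀ i : {η // η ∈ F}, -(if i = e m then (1 : ℤ) else 0) ≤ ∑ j, (A j : ℤ) *
        excCurveDegree π (CartierDivisor.ofIsEffectiveCartier (primeDivisorIdeal (j : X))
          (isEffectiveCartier_primeDivisorIdeal_of_isRegular hX (hF j j.2))) i) → A = 0)
    {x : T} (hx : x ∈ cohomologyAnnihilatorOfDegree T 3) (hx0 : x ≠ 0)
    (k : ℕ) (hk1 : 1 ≤ k) (hk2 : k ≤ ℓ) :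
    ((min k (ℓ + 1 - k) : ℕ) : ℤ) ≤ Scheme.ord (baseToFunctionField π x) (e k : {η // η ∈ F}) := by
  classical
  set M : {η // η ∈ F} → {η // η ∈ F} → ℤ := fun j i => excCurveDegree π
    (CartierDivisor.ofIsEffectiveCartier (primeDivisorIdeal (j : X))
      (isEffectiveCartier_primeDivisorIdeal_of_isRegular hX (hF j j.2))) i with hMdef
  have hoff : ∀ i j : {η // η ∈ F}, i ≠ j → 0 ≤ M i j := fun i j hij =>
    excCurveDegree_primeDivisor_nonneg_of_ne π hX (hF i i.2) (hF j j.2) (hFexc j j.2)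
      fun h => hij (Subtype.ext h)
  -- the pointed ceiling with `A₀ = 0`: `Z₀ ≤ ord(x)`
  have hA₀ : ∀ A : {η // η ∈ F} → ℕ, (∀ i : {η // η ∈ F}, -(if i = e m then (1 : ℤ) else 0) ≤
      ∑ j, (A j : ℤ) * M j i) → A ≤ 0 := fun A hA => (hNP A hA).le
  have hceil := least_sub_greatest_le_ord_of_mem_cohomologyAnnihilatorOfDegree_three π hX hπ hT F hF hFexc hFE hneg
    (e m) hγ hγE hΓ Z₀ 0 hZ₀ hA₀ hx hx0
  have hord : ∀ i : {η // η ∈ F}, (Z₀ i : ℤ) ≤ Scheme.ord (baseToFunctionField π x) i := fun i => by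
    have h := hceil i
    simp only [Pi.zero_apply, Nat.cast_zero, sub_zero] at h
    exact h
  -- the lattice consumer on the path
  exact PersistencePointedCyclesPath.pyramid_le_of_dominates_pointed M hoff ℓ m e hinj hdiag hadj hm1 hm2 hmid1 hmid2
    Z₀ hZ₀mem (fun i => Scheme.ord (baseToFunctionField π x) i) hord k hk1 hk2

end Summit.ResolutionOfSingularities.ResolutionOfSingularities.Theorems.HomologicalConductor.PersistencePointedCeiling

end
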